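import Literature.MathematicalPhysics.QuantumLattice.FermiRG.Salmhofer1998Sec6
import Literature.MathematicalPhysics.QuantumLattice.FermiRG.Salmhofer1998OverlappingLoopInputs
import Literature.MathematicalPhysics.QuantumLattice.FermiRG.Salmhofer1998PowerCountingProof
import HarnessLib

/-!
# Salmhofer 1998, Theorem 3 (the ladder four-point function): proof — `LadderFourPointBound_holds`

This file DISCHARGES the named fact `LadderFourPointBound` (F-093, `Sal98.T3`) of
`Salmhofer1998Sec6` (F7e): M. Salmhofer, *Continuous renormalization for fermions and Fermi liquid
theory*, Commun. Math. Phys. 194 (1998) 249–295, arXiv:cond-mat/9706188, §6.2 Theorem 3 (TeX `\BLsatz`,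
p.23 L169–183 of the arXiv source):

> There is a constant `L₂` such that `|B_r(t)|₀ ≤ L₂^r (½(1+t))^{r-1} ≤ L₂^r |log(βε₀)|^{r-1}`.  The series
> `Σ_r λ^r B_r(t)` converges uniformly in `t` and `P` if `|λ log βε₀| < L₂⁻¹`.
> *Proof.* This follows immediately by induction from (6.17) by use of (6.14) with `i = 2` and `α = 0`. □

No new definition of a notion and no new fact is introduced (D-0026): the one `def` below, `bubbleTerm`, is
the closed form of an existing expression (the `(4;4,4,2)` summand of F7e's `momQuadTerm`), proved equal to it
in `momQuadTerm_four_selLadder`; everything else is a theorem.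

## The printed proof and how it is followed

Print's induction runs on the integral form (Remark 5, (5.9)) of the ladder RGE (6.15)–(6.17):
`B_r(t|P) = B_r(0|P) + ½ 𝔸₄ ∫₀ᵗ ds Q_{4,r,2}(s|P)`, where `Q_{4,r,2}` is the bubble (6.17):
`κ_{442}· i!· i · ∫ dk Σ_{σ,j} (-Ċ̄_s(K₁)) C̄_s(K₂) B_{r₁}(s|P₁,P₂,K₁,K₂) B_{r₂}(s|∼K₂,∼K₁,P₃,P₄)` summed over
`r₁ + r₂ = r`, and Lemma 8 (6.14) at `i = 2`, `α = 0` bounds the loop by `4^i (8J₁)^{i-1} B₀ |B_{r₁}|₀ |B_{r₂}|₀`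
uniformly in the external momenta.  The file mirrors this:

* §A (reflection `k → -k` of the loop line, print p.22 L78) and §C (`lintegral_bubble_le_loopY`,
  `norm_bubbleTerm_le`) are the `i = 2`, `α = 0` instance of Lemma 8: the sup norm of the bubble at orders
  `(r₁, r₂)` is at most `64 · A₁ A₂ · Y` when `|B_{r_k}(s)|₀ ≤ A_k` and the one-loop integral (6.7)
  `loopY … 0 1 s ≤ Y`; with F7e's hypothesis `Y = 8 J₁ B` this is (6.14) (`4^i (8J₁)^{i-1} B`, `i = 2`, and the
  `2·2·…` spin/branch sums give the `64 = 4 · 16`; print's `4^i` counts them the same way, p.22 L95–103).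
* §B identifies F7e's generic right-hand side `momQuadTerm latt β selLadder … 4 r t P` with
  `Σ_{r₁=1}^{r-1} 36 · bubbleTerm … r₁ (r-r₁) t P` (`κ_{4,4,2} = C(4,2)² = 36`, Proposition 2 p.12 L93–94).
* §D: the model propagator `C̄_s` vanishes identically for `s > T* := log(βε₀/π)` (Lemma 4, p.19 L133–135:
  `|ω_β(k₀)| ≥ π/β > ε_s`), hence so does the bubble; and the elementary integral
  `∫₀^m ((1+s)/2)^n ds = (2/(n+1)) (((1+m)/2)^{n+1} - (1/2)^{n+1})`.
* §E `ladder_inductive_bound` is print's induction ("by induction from (6.17)"), run with the explicit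
  inductive statement `|B_r(t)|₀ ≤ (L^r/(1+Γ)) ((1 + min(t,T*))/2)^{r-1}`, `Γ = 36·64·8 J₁ B = 18432 J₁ B`,
  `L = 2w(1+Γ)` (`w^r` bounds the initial data): the step integrates the bound `(r-1) Γ (L^r/(1+Γ)²)
  ((1+s)/2)^{r-2} · 1(s ≤ T*)` of the right-hand side exactly in `s` (the factor `1/(r-1)` from the
  `s`-integral cancels the `r - 1` choices of `r₁`, which is why the bound is `L₂^r` and not `r! L₂^r`), and
  `|𝔸₄ F|₀ ≤ |F|₀` (p.12 L116–122).  `LadderFourPointBound_holds` then takes `L₂ = max(L, 1)`: clause (i)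
  from `min(t,T*) ≤ t`; clause (ii) from `(1 + T*)/2 ≤ log(βε₀)` (as `βε₀ ≥ 6 > e` and `T* ≤ log βε₀`) — this
  is where print's second inequality `(½(1+t))^{r-1} ≤ |log βε₀|^{r-1}` ("for `t ≤ log βε₀`", the flow stops
  at `ε_t = π/β`) is made unconditional in `t`; clause (iii) is the Weierstrass M-test
  (`tendstoUniformlyOn_tsum_nat`) with the geometric majorant `|λ|L₂ (|λ| L₂ |log βε₀|)^r`, ratio `< 1` iff
  `|λ log βε₀| < L₂⁻¹`.

Deviations from print, all on the safe side: the constants are explicit (print: "a constant `L₂`"); the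
theorem is typed (F7e revision 4) for the many-fermion propagators (5.17) under `M.Hyp`, `IsCutoff χ₁`,
`βε₀ ≥ 6`, exactly as Theorems 4–7 of F7e, because bounding the spin sum inside the loop integral term by
term uses the measurability of `C̄_s, Ċ̄_s` (`measurable_modelProp`, `measurable_modelPropDot`); the bounds
(i)–(ii) are proved at every leg configuration, the Matsubara restriction `IsMats` of (ii)–(iii) in F-093 is
simply not needed.

Inputs: F7e (`Salmhofer1998Sec6`: `loopY`, `momQuadTerm`, `IsLadderSolution`, `modelProp[Dot]`,
`LadderFourPointBound`), the companion `Salmhofer1998OverlappingLoopInputs` (`loopWeight_eq_pow`,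
`measurable_modelProp_toMats`, Lemma 4 vanishing `modelProp_toMats`-type facts), F7a–F7d vocabulary
(`kappa`, `antisym`, `legProp`, `legFlip`, `toMats`, `omegaStep`, `bzBox`, `loopSet`, `loopInt`), Mathlib.

## References
* [Sal98] M. Salmhofer, Commun. Math. Phys. 194 (1998) 249–295, arXiv:cond-mat/9706188 — bib key
  `Salmhofer1998`; locators `p.NN Lmm` refer to page/line of the arXiv TeX source as materialised by `lit`.
-/

noncomputable section

open MeasureTheory Filter
open scoped Topology ENNReal

namespace Literature.MathematicalPhysics.QuantumLattice.FermiRG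

namespace Salmhofer1998

variable {d : ℕ}

/-! ### §A. Reflection of the loop momentum (print: "after a change of variables `k_j → (-1)^{l_j} k_j`", p.22 L78) -/

/-- Off the lattice `(2π/β)ℤ` the step function is odd: `ω_β(-p₀) = -ω_β(p₀)`.
[cite: Salmhofer1998, §5.4 (5.13) (p.19 L93–98)] -/
theorem omegaStep_neg_of_notMem {β p : ℝ} (hp : β * p / (2 * Real.pi) ∉ Set.range (Int.cast : ℤ → ℝ)) :
    omegaStep β (-p) = -omegaStep β p := by
  unfold omegaStep matsFreq
  have h1 : β * -p / (2 * Real.pi) = -(β * p / (2 * Real.pi)) := by ring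
  rw [h1, Int.ceil_neg, (Int.ceil_eq_floor_add_one_iff_notMem _).mpr hp]
  push_cast
  ring

/-- `ω_β(-k₀) = -ω_β(k₀)` for almost every `k = (k₀, 𝐤)` (the exceptional frequencies `(2π/β)ℤ` are countable).
[cite: Salmhofer1998, §5.4 (5.13) (p.19 L93–98)] -/
theorem toMats_neg_ae (β : ℝ) : ∀ᵐ k : FMom d ∂volume, toMats β (-k) = -toMats β k := by
  rcases eq_or_ne β 0 with rfl | hβ
  · refine Filter.Eventually.of_forall fun k => ?_
    simp [toMats, omegaStep, matsFreq]
  · have hnull : volume {x : ℝ | β * x / (2 * Real.pi) ∈ Set.range (Int.cast : ℤ → ℝ)} = 0 := by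
      have hsub : {x : ℝ | β * x / (2 * Real.pi) ∈ Set.range (Int.cast : ℤ → ℝ)} ⊆
          Set.range (fun n : ℤ => 2 * Real.pi * n / β) := by
        rintro x ⟨n, hn⟩
        refine ⟨n, ?_⟩
        have hπ : Real.pi ≠ 0 := Real.pi_ne_zero
        field_simp
        field_simp at hn
        linarith
      exact measure_mono_null hsub ((Set.countable_range _).measure_zero volume)
    have hprod : volume ({x : ℝ | β * x / (2 * Real.pi) ∈ Set.range (Int.cast : ℤ → ℝ)} ×ˢ
        (Set.univ : Set (Mom d))) = 0 := by
      rw [Measure.volume_eq_prod, Measure.prod_prod, hnull, zero_mul]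
    rw [ae_iff]
    refine measure_mono_null (fun k hk => ?_) hprod
    simp only [Set.mem_setOf_eq] at hk
    refine ⟨?_, Set.mem_univ _⟩
    simp only [Set.mem_setOf_eq]
    by_contra hcon
    apply hk
    simp [toMats, omegaStep_neg_of_notMem hcon]

/-- The boundary hyperplanes of the Brillouin box are Lebesgue-null. [folklore] -/
private theorem volume_bzBox_boundary (latt : ℝ) :
    volume {q : Mom d | ∃ i, q i = -(Real.pi / latt) ∨ q i = Real.pi / latt} = 0 := by
  have h : {q : Mom d | ∃ i, q i = -(Real.pi / latt) ∨ q i = Real.pi / latt} =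
      ⋃ i : Fin d, ({q : Mom d | q i = -(Real.pi / latt)} ∪ {q : Mom d | q i = Real.pi / latt}) := by
    ext q; simp
  rw [h]
  refine measure_iUnion_null fun i => measure_union_null ?_ ?_ <;>
  · rw [MeasureTheory.volume_pi]; exact Measure.pi_hyperplane _ i _

/-- The reflected Brillouin box differs from the box by a null set: `ℝ × 𝓑` and `-(ℝ × 𝓑)` agree a.e.
[cite: Salmhofer1998, §2.3 (p.6 L142–144)] -/
theorem prod_bzBox_ae_eq_neg (latt : ℝ) :
    ((Set.univ : Set ℝ) ×ˢ bzBox d latt : Set (FMom d)) =ᵐ[volume]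
      (Neg.neg ⁻¹' ((Set.univ : Set ℝ) ×ˢ bzBox d latt) : Set (FMom d)) := by
  set S : Set (FMom d) := (Set.univ : Set ℝ) ×ˢ bzBox d latt
  have hN : volume ((Set.univ : Set ℝ) ×ˢ
      {q : Mom d | ∃ i, q i = -(Real.pi / latt) ∨ q i = Real.pi / latt}) = 0 := by
    rw [Measure.volume_eq_prod, Measure.prod_prod, volume_bzBox_boundary, mul_zero]
  refine (ae_eq_set.mpr ⟨?_, ?_⟩)
  · refine measure_mono_null (fun k hk => ?_) hN
    obtain ⟨hkS, hkT⟩ := hk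
    simp only [S, Set.mem_preimage, Set.mem_prod, Set.mem_univ, true_and, bzBox, Set.mem_univ_pi,
      Set.mem_Ico, Prod.snd_neg, Pi.neg_apply, not_forall] at hkS hkT
    obtain ⟨i, hi⟩ := hkT
    refine ⟨Set.mem_univ _, i, Or.inl ?_⟩
    have h1 := hkS i
    by_contra hne
    apply hi
    have h2 : -(Real.pi / latt) < k.2 i := lt_of_le_of_ne h1.1 (Ne.symm hne)
    constructor <;> [linarith [h1.2]; linarith [h2]]
  · refine measure_mono_null (fun k hk => ?_) hN
    obtain ⟨hkT, hkS⟩ := hk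
    simp only [S, Set.mem_preimage, Set.mem_prod, Set.mem_univ, true_and, bzBox, Set.mem_univ_pi,
      Set.mem_Ico, Prod.snd_neg, Pi.neg_apply, not_forall] at hkS hkT
    obtain ⟨i, hi⟩ := hkS
    refine ⟨Set.mem_univ _, i, Or.inr ?_⟩
    have h1 := hkT i
    by_contra hne
    apply hi
    have h2 : k.2 i < Real.pi / latt := lt_of_le_of_ne (by linarith [h1.1]) hne
    constructor <;> [linarith [h1.2]; linarith [h2]]

/-- Lebesgue measure on `ℝ × ℝ^d` is an additive Haar measure (used locally via `haveI`; no global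
instance is declared). [folklore] -/
private theorem isAddHaarMeasure_volume_FMom : (volume : Measure (FMom d)).IsAddHaarMeasure :=
  Measure.prod.instIsAddHaarMeasure _ _

/-- **Reflection of the loop line** ("after a change of variables `k → -k`", p.22 L78): for every
`Φ : ℝ × ℝ^d → [0,∞]`, `∫_{(ℝ×𝓑)^1} Φ(-ω̃(k)) dk = ∫_{(ℝ×𝓑)^1} Φ(ω̃(k)) dk` with `ω̃(k) = (ω_β(k₀), 𝐤)` — Lebesgue
measure is reflection invariant, the box is symmetric up to a null set, and `ω_β` is odd almost everywhere.
[cite: Salmhofer1998, §6.1 (p.22 L78–80)] -/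
theorem lintegral_loopSet_one_reflect (latt β : ℝ) (Φ : FMom d → ℝ≥0∞) :
    ∫⁻ K in loopSet d latt 1, Φ (-toMats β (K 0)) = ∫⁻ K in loopSet d latt 1, Φ (toMats β (K 0)) := by
  set S : Set (FMom d) := (Set.univ : Set ℝ) ×ˢ bzBox d latt with hS
  -- transfer to `ℝ × ℝ^d`
  have he : MeasurePreserving (MeasurableEquiv.funUnique (Fin 1) (FMom d)) volume volume :=
    volume_preserving_funUnique (Fin 1) (FMom d)
  have hpre : loopSet d latt 1 = (MeasurableEquiv.funUnique (Fin 1) (FMom d)) ⁻¹' S := by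
    ext K
    simp [loopSet, hS, MeasurableEquiv.funUnique, Fin.forall_fin_one, Fin.default_eq_zero]
  have htr : ∀ Ψ : FMom d → ℝ≥0∞,
      ∫⁻ K in loopSet d latt 1, Ψ (K 0) = ∫⁻ k in S, Ψ k := by
    intro Ψ
    rw [hpre]
    exact he.setLIntegral_comp_preimage_emb (MeasurableEquiv.measurableEmbedding _) Ψ S
  rw [htr (fun k => Φ (-toMats β k)), htr (fun k => Φ (toMats β k))]
  -- `Φ(-ω̃(k)) = Φ(ω̃(-k))` a.e.
  have hae : (fun k : FMom d => Φ (-toMats β k)) =ᵐ[volume.restrict S] fun k => Φ (toMats β (-k)) := by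
    refine ae_restrict_of_ae ?_
    filter_upwards [toMats_neg_ae (d := d) β] with k hk
    rw [hk]
  rw [lintegral_congr_ae hae]
  -- reflect: `∫_S Ψ(-k) = ∫_{-S} Ψ(k)` and `-S =ᵐ S`
  haveI := isAddHaarMeasure_volume_FMom (d := d)
  have hneg : MeasurePreserving (Neg.neg : FMom d → FMom d) volume volume := Measure.measurePreserving_neg _
  have h2 : ∫⁻ k in S, Φ (toMats β (-k)) = ∫⁻ k in Neg.neg ⁻¹' S, Φ (toMats β k) := by
    have hSS : S = Neg.neg ⁻¹' (Neg.neg ⁻¹' S : Set (FMom d)) := by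
      ext k; simp
    conv_lhs => rw [hSS]
    exact hneg.setLIntegral_comp_preimage_emb (MeasurableEquiv.neg (FMom d)).measurableEmbedding
      (fun k => Φ (toMats β k)) _
  rw [h2]
  exact setLIntegral_congr (prod_bzBox_ae_eq_neg latt).symm

/-! ### §B. The bubble term `Q_{4,r,2}` of (6.17): the ladder RGE's right-hand side in closed form -/

/-- **The bubble term of (6.17)** at orders `(r₁, r₂)`: the `(m; m₁, m₂, i) = (4; 4, 4, 2)` summand of the
momentum-space bilinear term `momQuadTerm` (F7e), i.e. `i!·i ∫dK₂ Σ_{σ₁,j₁} (-Ċ̄_t(K₁)) C̄_t(K₂)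
I₁(t | P₁, P₂, K₁, K₂) I₂(t | ∼K₂, ∼K₁, P₃, P₄)` with `k₁ = -k₂ + p₁ + p₂` (print: `K' = (p₁+p₂-k, …)`).  Written
with the literal index arithmetic of `momQuadTerm` so that the identification below is definitional.
[cite: Salmhofer1998, (6.17) (p.23 L101–112)] -/
def bubbleTerm (latt β : ℝ) (C Cdot : ℝ → FMom d → ℂ) (I₁ I₂ : MomFamily d) (r₁ r₂ : ℕ) (t : ℝ)
    (P : Fin 4 → Leg d) : ℂ :=
  (((Nat.factorial 2 * 2 : ℕ) : ℝ) : ℂ) *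
    loopInt latt β 1 fun K : Fin 1 → Leg d =>
      ∑ sj₁ : Fin 2 × Fin 2,
        (-(legProp Cdot t
            ((-(∑ s, (K s).1) + ∑ μ : Fin 2, (P ⟨μ.val, by omega⟩).1), sj₁))) *
          (∏ s, legProp C t (K s)) *
          I₁ 4 r₁ t (fun j : Fin 4 =>
            if hj : j.val < 2 then P ⟨j.val, by omega⟩
            else if hj' : j.val = 2 then
              ((-(∑ s, (K s).1) + ∑ μ : Fin 2, (P ⟨μ.val, by omega⟩).1), sj₁)
            else K ⟨j.val - 2 - 1, by omega⟩) *
          I₂ 4 r₂ t (fun j : Fin 4 =>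
            if hj : j.val < 1 then legFlip (K ⟨0 - j.val, by omega⟩)
            else if hj' : j.val = 1 then
              legFlip ((-(∑ s, (K s).1) + ∑ μ : Fin 2, (P ⟨μ.val, by omega⟩).1), sj₁)
            else P ⟨2 + (j.val - 2), by omega⟩)

/-- `κ_{4,4,2} = C(4,2)² = 36` (p.12 L93–94). [cite: Salmhofer1998, Proposition 2 (p.12 L93–94)] -/
theorem kappa_four_four_two : kappa 4 4 2 = 36 := by
  decide

/-- **(6.17): the ladder RGE's right-hand side is the bubble sum** — with the ladder selector of Definition 3
only `(m₁, m₂, i) = (4, 4, 2)` survives in `∫dκ_{4,r}`, so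
`Q^L_{4,r}(t | P) = Σ_{r₁+r₂=r} κ_{442} · bubbleTerm(r₁, r₂)` (`κ_{442} = 36`; print's "144" collects `36 · 2!·2`).
[cite: Salmhofer1998, (6.17) (p.23 L95–112) and Definition 3 (p.23 L142–150)] -/
theorem momQuadTerm_four_selLadder (latt β : ℝ) (C Cdot : ℝ → FMom d → ℂ) (I₁ I₂ : MomFamily d) (r : ℕ)
    (t : ℝ) (P : Fin 4 → Leg d) :
    momQuadTerm latt β selLadder C Cdot I₁ I₂ 4 r t P =
      ∑ r₁ ∈ Finset.Icc 1 (r - 1), (36 : ℂ) * bubbleTerm latt β C Cdot I₁ I₂ r₁ (r - r₁) t P := by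
  unfold momQuadTerm kappaSum
  refine Finset.sum_congr rfl fun r₁ hr₁ => ?_
  simp only [Finset.mem_Icc] at hr₁
  -- every term with `(m₁, m₂) ≠ (4, 4)` vanishes by the ladder selector
  have hzero : ∀ m₁ m₂ i : ℕ, ¬ (m₁ = 4 ∧ m₂ = 4) →
      (if MIndex mfDeg r₁ (r - r₁) 4 m₁ m₂ i = true then
        (kappa m₁ m₂ i : ℂ) *
          (if h : i ≤ m₁ ∧ i ≤ m₂ ∧ m₁ + m₂ = 4 + 2 * i then
            (if selLadder 4 m₁ m₂ i then
              (((i.factorial * i : ℕ) : ℝ) : ℂ) *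
                loopInt latt β (i - 1) fun K : Fin (i - 1) → Leg d =>
                  ∑ sj₁ : Fin 2 × Fin 2,
                    (-(legProp Cdot t
                        ((-(∑ s, (K s).1) + ∑ μ : Fin (m₁ - i), (P ⟨μ.val, by omega⟩).1), sj₁))) *
                      (∏ s, legProp C t (K s)) *
                      I₁ m₁ r₁ t (fun j : Fin m₁ =>
                        if hj : j.val < m₁ - i then P ⟨j.val, by omega⟩
                        else if hj' : j.val = m₁ - i then
                          ((-(∑ s, (K s).1) + ∑ μ : Fin (m₁ - i), (P ⟨μ.val, by omega⟩).1), sj₁)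
                        else K ⟨j.val - (m₁ - i) - 1, by omega⟩) *
                      I₂ m₂ (r - r₁) t (fun j : Fin m₂ =>
                        if hj : j.val < i - 1 then legFlip (K ⟨(i - 2) - j.val, by omega⟩)
                        else if hj' : j.val = i - 1 then
                          legFlip ((-(∑ s, (K s).1) + ∑ μ : Fin (m₁ - i), (P ⟨μ.val, by omega⟩).1), sj₁)
                        else P ⟨(m₁ - i) + (j.val - i), by omega⟩)
            else 0)
          else 0)
      else 0) = 0 := by
    intro m₁ m₂ i hm
    have hsel : selLadder 4 m₁ m₂ i = false := by
      simp [selLadder]; tauto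
    simp [hsel]
  have h4a : 4 ∈ Finset.Icc 1 (mfDeg r₁) := by
    simp only [Finset.mem_Icc, mfDeg]; omega
  have h4b : 4 ∈ Finset.Icc 1 (mfDeg (r - r₁)) := by
    simp only [Finset.mem_Icc, mfDeg]; omega
  rw [Finset.sum_eq_single_of_mem 4 h4a (fun m₁ _ hm₁ =>
    Finset.sum_eq_zero fun m₂ _ => Finset.sum_eq_zero fun i _ => hzero m₁ m₂ i (fun h => hm₁ h.1))]
  rw [Finset.sum_eq_single_of_mem 4 h4b (fun m₂ _ hm₂ =>
    Finset.sum_eq_zero fun i _ => hzero 4 m₂ i (fun h => hm₂ h.2))]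
  have h2 : 2 ∈ Finset.Icc 1 (4 + 4) := by simp
  rw [Finset.sum_eq_single_of_mem 2 h2 (fun i _ hi => by
    have hM : MIndex mfDeg r₁ (r - r₁) 4 4 4 i = false := by
      rw [Bool.eq_false_iff]
      intro h
      simp only [MIndex, mfDeg, Bool.and_eq_true, decide_eq_true_eq] at h
      omega
    simp [hM])]
  have hM : MIndex mfDeg r₁ (r - r₁) 4 4 4 2 = true := by
    simp only [MIndex, mfDeg, Bool.and_eq_true, decide_eq_true_eq]
    refine ⟨⟨⟨⟨⟨⟨⟨by norm_num, by norm_num⟩, by omega⟩, by norm_num⟩, by omega⟩, by norm_num⟩,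
      by norm_num⟩, by norm_num⟩
  have hsel : selLadder 4 4 4 2 = true := by decide
  rw [if_pos hM, kappa_four_four_two, dif_pos (by omega), if_pos hsel]
  simp only [Nat.cast_ofNat]
  rfl

/-! ### §C. The bubble estimate: `|Q_{4,r,2}|` through `Y_{0,2}` ((6.15) with `i = 2`, `α = 0`) -/

/-- `|C̄_t(K)| = |Ĉ_t(±k)|`: the propagator insertion (5.3) is a sign times `Ĉ_t` at `k` or `-k`.
[cite: Salmhofer1998, §5.1 (5.3) (p.17 L61–76)] -/
theorem norm_legProp (f : ℝ → FMom d → ℂ) (t : ℝ) (K : Leg d) :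
    ‖legProp f t K‖ = ‖f t ((if K.2.2 = 0 then (-1 : ℝ) else 1) • K.1)‖ := by
  unfold legProp
  split_ifs with h
  · rw [norm_neg, neg_one_smul]
  · rw [one_smul]

/-- One loop line against `Y_{0,2}`: for signs `s₁, s₂ ∈ {±1}` and any `Q`,
`∫_{(ℝ×𝓑)^1} dk/(2π)^{d+1} |Ĉ_t(s₂ k)| |Ċ_t(s₁(-k + Q))| ≤ Y_{0,2}(t)` — directly for `s₂ = 1`, after the reflection
`k → -k` for `s₂ = -1` ("after a change of variables", p.22 L78).  Any scale family.
[cite: Salmhofer1998, §6.1 (6.5)–(6.7) (p.22 L78–115)] -/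
theorem lintegral_bubble_le_loopY (latt β : ℝ) (C Cdot : ℝ → FMom d → ℂ) (t : ℝ) (Q : FMom d)
    {s₁ s₂ : ℝ} (hs₁ : s₁ = 1 ∨ s₁ = -1) (hs₂ : s₂ = 1 ∨ s₂ = -1) :
    ∫⁻ K in loopSet d latt 1,
        ENNReal.ofReal (loopWeight d 1) * ‖C t (s₂ • toMats β (K 0))‖ₑ *
          ‖Cdot t (s₁ • (-toMats β (K 0) + Q))‖ₑ ≤
      loopY latt β C Cdot 0 1 t := by
  -- reduce `s₂ = -1` to `s₂ = 1` by the reflection of the loop line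
  have key : ∀ (s : ℝ), (s = 1 ∨ s = -1) →
      ∫⁻ K in loopSet d latt 1,
          ENNReal.ofReal (loopWeight d 1) * ‖C t (toMats β (K 0))‖ₑ *
            ‖Cdot t (s • toMats β (K 0) + s₁ • Q)‖ₑ ≤
        loopY latt β C Cdot 0 1 t := by
    intro s hs
    unfold loopY
    refine le_iSup_of_le (s₁ • Q) (le_iSup_of_le (fun _ => decide (s = 1)) (le_of_eq ?_))
    refine lintegral_congr fun K => ?_
    rw [multiMomPartial_zero, Fin.prod_univ_one, Fin.sum_univ_one]
    rcases hs with rfl | rfl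
    · simp
    · norm_num
  rcases hs₂ with rfl | rfl
  · have h := key (-s₁) (by rcases hs₁ with rfl | rfl <;> norm_num)
    refine le_trans (le_of_eq (lintegral_congr fun K => ?_)) h
    rw [one_smul, smul_add, smul_neg, neg_smul]
  · have h := key s₁ hs₁
    have hrefl := lintegral_loopSet_one_reflect latt β (fun u : FMom d =>
      ENNReal.ofReal (loopWeight d 1) * ‖C t u‖ₑ * ‖Cdot t (s₁ • (u + Q))‖ₑ)
    calc ∫⁻ K in loopSet d latt 1, ENNReal.ofReal (loopWeight d 1) * ‖C t ((-1 : ℝ) • toMats β (K 0))‖ₑ *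
            ‖Cdot t (s₁ • (-toMats β (K 0) + Q))‖ₑ
        = ∫⁻ K in loopSet d latt 1, ENNReal.ofReal (loopWeight d 1) * ‖C t (-toMats β (K 0))‖ₑ *
            ‖Cdot t (s₁ • (-toMats β (K 0) + Q))‖ₑ := by
          refine lintegral_congr fun K => ?_
          rw [neg_one_smul]
      _ = ∫⁻ K in loopSet d latt 1, ENNReal.ofReal (loopWeight d 1) * ‖C t (toMats β (K 0))‖ₑ *
            ‖Cdot t (s₁ • (toMats β (K 0) + Q))‖ₑ := hrefl
      _ = ∫⁻ K in loopSet d latt 1, ENNReal.ofReal (loopWeight d 1) * ‖C t (toMats β (K 0))‖ₑ *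
            ‖Cdot t (s₁ • toMats β (K 0) + s₁ • Q)‖ₑ := by
          refine lintegral_congr fun K => ?_
          rw [smul_add]
      _ ≤ loopY latt β C Cdot 0 1 t := h

/-- `(x, 𝐤) ↦ Ċ_t(x, E(𝐤))` is Borel measurable (indeed continuous: `ε_t⁻¹ Θ(x/ε_t, E(𝐤)/ε_t)` with the smooth profile
`Θ` of toolkit I). [cite: Salmhofer1998, §5.4–5.5 (p.20 L4–6)] -/
theorem measurable_modelPropDot {M : ModelData d} (hM : M.Hyp) {χ₁ : ℝ → ℝ} (hχ : IsCutoff χ₁) (t : ℝ) :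
    Measurable fun k : FMom d => modelPropDot M χ₁ t k := by
  have hfun : (fun k : FMom d => modelPropDot M χ₁ t k) = fun k =>
      (((epsT M.eps0 t)⁻¹ : ℝ) : ℂ) * kerProfile χ₁ (k.1 / epsT M.eps0 t, M.E k.2 / epsT M.eps0 t) := by
    funext k
    simp only [modelPropDot]
    rw [covCDot_eq_scaledSlice hχ hM.eps0_pos, scaledSlice_apply]
  rw [hfun]
  have hE : Measurable fun k : FMom d => M.E k.2 :=
    hM.contDiff_E.continuous.measurable.comp measurable_snd
  have hΘ : Continuous (kerProfile χ₁) := (contDiff_kerProfile hχ).continuous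
  exact measurable_const.mul (hΘ.measurable.comp ((measurable_fst.div_const _).prodMk (hE.div_const _)))

/-- `(x, 𝐤) ↦ 𝒞_t(x, E(𝐤))` is Borel measurable. [cite: Salmhofer1998, §5.4 (5.17) (p.19 L118–126)] -/
theorem measurable_modelProp {M : ModelData d} (hM : M.Hyp) {χ₁ : ℝ → ℝ} (hχ : IsCutoff χ₁) (t : ℝ) :
    Measurable fun k : FMom d => modelProp M χ₁ t k := by
  have hfun : (fun k : FMom d => modelProp M χ₁ t k) = fun k : FMom d =>
      ((cutoffExt χ₁ ((epsT M.eps0 t)⁻¹ ^ 2 * (k.1 ^ 2 + (M.E k.2) ^ 2)) : ℝ) : ℂ) /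
        (Complex.I * (k.1 : ℂ) - (M.E k.2 : ℂ)) := by
    funext k
    simp only [modelProp, covC]
    rw [cutoffExt_eq hχ (by positivity)]
  rw [hfun]
  have hE : Measurable fun k : FMom d => M.E k.2 :=
    hM.contDiff_E.continuous.measurable.comp measurable_snd
  have hnum : Measurable fun k : FMom d =>
      ((cutoffExt χ₁ ((epsT M.eps0 t)⁻¹ ^ 2 * (k.1 ^ 2 + (M.E k.2) ^ 2)) : ℝ) : ℂ) :=
    Complex.measurable_ofReal.comp ((contDiff_cutoffExt hχ).continuous.measurable.comp
      (measurable_const.mul ((measurable_fst.pow_const 2).add (hE.pow_const 2))))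
  have hden : Measurable fun k : FMom d => Complex.I * (k.1 : ℂ) - (M.E k.2 : ℂ) :=
    (measurable_const.mul (Complex.measurable_ofReal.comp measurable_fst)).sub
      (Complex.measurable_ofReal.comp hE)
  exact hnum.div hden

/-- `k ↦ (ω_β(k₀), 𝐤)` is measurable. [cite: Salmhofer1998, §5.4 (5.13) (p.19 L93–98)] -/
theorem measurable_toMats (β : ℝ) : Measurable (toMats (d := d) β) :=
  ((measurable_omegaStep β).comp measurable_fst).prodMk measurable_snd

/-- **The bubble estimate** ((6.6)/(6.15) with `i = 2`, `α = 0`, for the many-fermion propagator): if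
`|I₁(4, r₁)| ≤ A₁` and `|I₂(4, r₂)| ≤ A₂` at all legs and `Y_{0,2}(t) ≤ Y`, then
`|bubbleTerm(r₁, r₂)(t | P)| ≤ 64 A₁ A₂ Y` (`64 = (2!·2) · 4 · 4`: the prefactor, the spin/Nambu sum of the loop
line and that of the cut line).  Measurability of the propagators enters when the spin sum is taken out of the
lower integral. [cite: Salmhofer1998, §6.1 (6.5)–(6.6) (p.22 L78–106) and Theorem 3 proof (p.23 L180–183)] -/
theorem norm_bubbleTerm_le {M : ModelData d} (hM : M.Hyp) {χ₁ : ℝ → ℝ} (hχ : IsCutoff χ₁)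
    {I₁ I₂ : MomFamily d} {r₁ r₂ : ℕ} {t β A₁ A₂ Y : ℝ} (hA₁ : 0 ≤ A₁) (hA₂ : 0 ≤ A₂) (hY : 0 ≤ Y)
    (hI₁ : ∀ L : Fin 4 → Leg d, ‖I₁ 4 r₁ t L‖ ≤ A₁) (hI₂ : ∀ L : Fin 4 → Leg d, ‖I₂ 4 r₂ t L‖ ≤ A₂)
    (hloop : loopY M.latt β (modelProp M χ₁) (modelPropDot M χ₁) 0 1 t ≤ ENNReal.ofReal Y)
    (P : Fin 4 → Leg d) :
    ‖bubbleTerm M.latt β (modelProp M χ₁) (modelPropDot M χ₁) I₁ I₂ r₁ r₂ t P‖ ≤ 64 * (A₁ * A₂ * Y) := by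
  set C := modelProp M χ₁ with hCdef
  set Cd := modelPropDot M χ₁ with hCddef
  set Q : FMom d := ∑ μ : Fin 2, (P ⟨μ.val, by omega⟩).1 with hQ
  -- the integrand of the loop line, for a spin/Nambu assignment `sj` of the loop line
  have hterm : ∀ (sj : Fin 1 → Fin 2 × Fin 2),
      ‖∫ k in loopSet d M.latt 1, (loopWeight d 1 : ℂ) *
          ∑ sj₁ : Fin 2 × Fin 2,
            (-(legProp Cd t ((-(∑ s, ((fun s => (toMats β (k s), sj s)) s).1) + Q), sj₁))) *
              (∏ s, legProp C t ((fun s => (toMats β (k s), sj s)) s)) *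
              I₁ 4 r₁ t (fun j : Fin 4 =>
                if hj : j.val < 2 then P ⟨j.val, by omega⟩
                else if hj' : j.val = 2 then
                  ((-(∑ s, ((fun s => (toMats β (k s), sj s)) s).1) + Q), sj₁)
                else (fun s => (toMats β (k s), sj s)) ⟨j.val - 2 - 1, by omega⟩) *
              I₂ 4 r₂ t (fun j : Fin 4 =>
                if hj : j.val < 1 then legFlip ((fun s => (toMats β (k s), sj s)) ⟨0 - j.val, by omega⟩)
                else if hj' : j.val = 1 then
                  legFlip ((-(∑ s, ((fun s => (toMats β (k s), sj s)) s).1) + Q), sj₁)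
                else P ⟨2 + (j.val - 2), by omega⟩)‖ ≤ 4 * (A₁ * A₂ * Y) := by
    intro sj
    -- signs of the cut line (`sj₁`) and of the loop line (`sj 0`)
    set s₂ : ℝ := if (sj 0).2 = 0 then -1 else 1 with hs₂def
    have hs₂ : s₂ = 1 ∨ s₂ = -1 := by rw [hs₂def]; split_ifs <;> simp
    have hlw : 0 ≤ loopWeight d 1 := loopWeight_nonneg d 1
    have hmeas0 : Measurable fun k : Fin 1 → FMom d => toMats β (k 0) :=
      (measurable_toMats β).comp (measurable_pi_apply 0)
    have hmeasC : ∀ s : ℝ, Measurable fun k : Fin 1 → FMom d => ‖C t (s • toMats β (k 0))‖ₑ := by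
      intro s
      have h1 : Measurable fun k : Fin 1 → FMom d => s • toMats β (k 0) := hmeas0.const_smul s
      exact ((measurable_modelProp hM hχ t).comp h1).enorm
    have hmeasCd : ∀ s : ℝ, Measurable fun k : Fin 1 → FMom d =>
        ‖Cd t (s • (-toMats β (k 0) + Q))‖ₑ := by
      intro s
      have h1 : Measurable fun k : Fin 1 → FMom d => s • (-toMats β (k 0) + Q) :=
        (hmeas0.neg.add_const Q).const_smul s
      exact ((measurable_modelPropDot hM hχ t).comp h1).enorm
    -- pointwise bound of the integrand
    have hpt : ∀ k : Fin 1 → FMom d,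
        ENNReal.ofReal ‖(loopWeight d 1 : ℂ) *
          ∑ sj₁ : Fin 2 × Fin 2,
            (-(legProp Cd t ((-(∑ s, ((fun s => (toMats β (k s), sj s)) s).1) + Q), sj₁))) *
              (∏ s, legProp C t ((fun s => (toMats β (k s), sj s)) s)) *
              I₁ 4 r₁ t (fun j : Fin 4 =>
                if hj : j.val < 2 then P ⟨j.val, by omega⟩
                else if hj' : j.val = 2 then
                  ((-(∑ s, ((fun s => (toMats β (k s), sj s)) s).1) + Q), sj₁)
                else (fun s => (toMats β (k s), sj s)) ⟨j.val - 2 - 1, by omega⟩) *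
              I₂ 4 r₂ t (fun j : Fin 4 =>
                if hj : j.val < 1 then legFlip ((fun s => (toMats β (k s), sj s)) ⟨0 - j.val, by omega⟩)
                else if hj' : j.val = 1 then
                  legFlip ((-(∑ s, ((fun s => (toMats β (k s), sj s)) s).1) + Q), sj₁)
                else P ⟨2 + (j.val - 2), by omega⟩)‖ ≤
        ∑ sj₁ : Fin 2 × Fin 2,
          ENNReal.ofReal (loopWeight d 1) * ‖C t (s₂ • toMats β (k 0))‖ₑ *
            ‖Cd t ((if sj₁.2 = 0 then (-1 : ℝ) else 1) • (-toMats β (k 0) + Q))‖ₑ *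
            ENNReal.ofReal (A₁ * A₂) := by
      intro k
      have hk1 : (-(∑ s : Fin 1, ((fun s => (toMats β (k s), sj s)) s).1) + Q) = -toMats β (k 0) + Q := by
        simp
      rw [hk1]
      have hreal : ‖(loopWeight d 1 : ℂ) *
          ∑ sj₁ : Fin 2 × Fin 2,
            (-(legProp Cd t (-toMats β (k 0) + Q, sj₁))) *
              (∏ s, legProp C t ((fun s => (toMats β (k s), sj s)) s)) *
              I₁ 4 r₁ t (fun j : Fin 4 =>
                if hj : j.val < 2 then P ⟨j.val, by omega⟩
                else if hj' : j.val = 2 then (-toMats β (k 0) + Q, sj₁)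
                else (fun s => (toMats β (k s), sj s)) ⟨j.val - 2 - 1, by omega⟩) *
              I₂ 4 r₂ t (fun j : Fin 4 =>
                if hj : j.val < 1 then legFlip ((fun s => (toMats β (k s), sj s)) ⟨0 - j.val, by omega⟩)
                else if hj' : j.val = 1 then legFlip (-toMats β (k 0) + Q, sj₁)
                else P ⟨2 + (j.val - 2), by omega⟩)‖ ≤
          ∑ sj₁ : Fin 2 × Fin 2,
            loopWeight d 1 * ‖C t (s₂ • toMats β (k 0))‖ *
              ‖Cd t ((if sj₁.2 = 0 then (-1 : ℝ) else 1) • (-toMats β (k 0) + Q))‖ * (A₁ * A₂) := by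
        rw [norm_mul, Complex.norm_real, Real.norm_of_nonneg hlw]
        refine (mul_le_mul_of_nonneg_left (norm_sum_le _ _) hlw).trans ?_
        rw [Finset.mul_sum]
        refine Finset.sum_le_sum fun sj₁ _ => ?_
        rw [norm_mul, norm_mul, norm_mul, norm_neg, Fin.prod_univ_one, norm_legProp, norm_legProp]
        have h1 := hI₁ (fun j : Fin 4 =>
                if hj : j.val < 2 then P ⟨j.val, by omega⟩
                else if hj' : j.val = 2 then (-toMats β (k 0) + Q, sj₁)
                else (fun s => (toMats β (k s), sj s)) ⟨j.val - 2 - 1, by omega⟩)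
        have h2 := hI₂ (fun j : Fin 4 =>
                if hj : j.val < 1 then legFlip ((fun s => (toMats β (k s), sj s)) ⟨0 - j.val, by omega⟩)
                else if hj' : j.val = 1 then legFlip (-toMats β (k 0) + Q, sj₁)
                else P ⟨2 + (j.val - 2), by omega⟩)
        have hn1 := norm_nonneg (Cd t ((if sj₁.2 = 0 then (-1 : ℝ) else 1) • (-toMats β (k 0) + Q)))
        have hn2 := norm_nonneg (C t (s₂ • toMats β (k 0)))
        simp only [hs₂def] at hn2 ⊢
        calc loopWeight d 1 * (‖Cd t ((if sj₁.2 = 0 then (-1 : ℝ) else 1) • (-toMats β (k 0) + Q))‖ *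
              ‖C t ((if (sj 0).2 = 0 then (-1 : ℝ) else 1) • toMats β (k 0))‖ * ‖I₁ 4 r₁ t _‖ * ‖I₂ 4 r₂ t _‖)
            ≤ loopWeight d 1 * (‖Cd t ((if sj₁.2 = 0 then (-1 : ℝ) else 1) • (-toMats β (k 0) + Q))‖ *
              ‖C t ((if (sj 0).2 = 0 then (-1 : ℝ) else 1) • toMats β (k 0))‖ * A₁ * A₂) := by
              gcongr
          _ = _ := by ring
      refine (ENNReal.ofReal_le_ofReal hreal).trans (le_of_eq ?_)
      rw [ENNReal.ofReal_sum_of_nonneg (fun sj₁ _ => by positivity)]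
      refine Finset.sum_congr rfl fun sj₁ _ => ?_
      rw [ENNReal.ofReal_mul (by positivity), ENNReal.ofReal_mul (by positivity), ENNReal.ofReal_mul hlw,
        ofReal_norm, ofReal_norm]
    -- integrate: Tonelli over the spin sum (measurability), then `Y_{0,2}`
    have hint : ∫⁻ k in loopSet d M.latt 1,
        ∑ sj₁ : Fin 2 × Fin 2,
          ENNReal.ofReal (loopWeight d 1) * ‖C t (s₂ • toMats β (k 0))‖ₑ *
            ‖Cd t ((if sj₁.2 = 0 then (-1 : ℝ) else 1) • (-toMats β (k 0) + Q))‖ₑ *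
            ENNReal.ofReal (A₁ * A₂) ≤ ENNReal.ofReal (4 * (A₁ * A₂ * Y)) := by
      have hmeasg : ∀ sj₁ : Fin 2 × Fin 2, Measurable fun k : Fin 1 → FMom d =>
          ENNReal.ofReal (loopWeight d 1) * ‖C t (s₂ • toMats β (k 0))‖ₑ *
            ‖Cd t ((if sj₁.2 = 0 then (-1 : ℝ) else 1) • (-toMats β (k 0) + Q))‖ₑ *
            ENNReal.ofReal (A₁ * A₂) := fun sj₁ =>
        ((measurable_const.mul (hmeasC s₂)).mul (hmeasCd _)).mul measurable_const
      rw [lintegral_finsetSum _ (fun sj₁ _ => hmeasg sj₁)]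
      have hone : ∀ sj₁ : Fin 2 × Fin 2,
          ∫⁻ k in loopSet d M.latt 1, ENNReal.ofReal (loopWeight d 1) * ‖C t (s₂ • toMats β (k 0))‖ₑ *
              ‖Cd t ((if sj₁.2 = 0 then (-1 : ℝ) else 1) • (-toMats β (k 0) + Q))‖ₑ *
              ENNReal.ofReal (A₁ * A₂) ≤ ENNReal.ofReal Y * ENNReal.ofReal (A₁ * A₂) := by
        intro sj₁
        have hm : Measurable fun k : Fin 1 → FMom d =>
            ENNReal.ofReal (loopWeight d 1) * ‖C t (s₂ • toMats β (k 0))‖ₑ *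
              ‖Cd t ((if sj₁.2 = 0 then (-1 : ℝ) else 1) • (-toMats β (k 0) + Q))‖ₑ :=
          (measurable_const.mul (hmeasC s₂)).mul (hmeasCd _)
        rw [lintegral_mul_const _ hm]
        gcongr
        have hs₁ : (if sj₁.2 = 0 then (-1 : ℝ) else 1) = 1 ∨ (if sj₁.2 = 0 then (-1 : ℝ) else 1) = -1 := by
          split_ifs <;> simp
        exact (lintegral_bubble_le_loopY M.latt β C Cd t Q hs₁ hs₂).trans hloop
      calc ∑ sj₁ : Fin 2 × Fin 2, ∫⁻ k in loopSet d M.latt 1,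
            ENNReal.ofReal (loopWeight d 1) * ‖C t (s₂ • toMats β (k 0))‖ₑ *
              ‖Cd t ((if sj₁.2 = 0 then (-1 : ℝ) else 1) • (-toMats β (k 0) + Q))‖ₑ * ENNReal.ofReal (A₁ * A₂)
          ≤ ∑ sj₁ : Fin 2 × Fin 2, ENNReal.ofReal Y * ENNReal.ofReal (A₁ * A₂) :=
            Finset.sum_le_sum fun sj₁ _ => hone sj₁
        _ = ENNReal.ofReal (4 * (A₁ * A₂ * Y)) := by
            rw [Finset.sum_const, Finset.card_univ, Fintype.card_prod, Fintype.card_fin, nsmul_eq_mul,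
              ← ENNReal.ofReal_mul hY]
            rw [show ((2 * 2 : ℕ) : ℝ≥0∞) = ENNReal.ofReal 4 by norm_num, ← ENNReal.ofReal_mul (by norm_num)]
            congr 1; ring
    refine (norm_integral_le_lintegral_norm _).trans ?_
    have hfin : ∫⁻ k in loopSet d M.latt 1, ENNReal.ofReal ‖(loopWeight d 1 : ℂ) *
          ∑ sj₁ : Fin 2 × Fin 2,
            (-(legProp Cd t ((-(∑ s, ((fun s => (toMats β (k s), sj s)) s).1) + Q), sj₁))) *
              (∏ s, legProp C t ((fun s => (toMats β (k s), sj s)) s)) *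
              I₁ 4 r₁ t (fun j : Fin 4 =>
                if hj : j.val < 2 then P ⟨j.val, by omega⟩
                else if hj' : j.val = 2 then
                  ((-(∑ s, ((fun s => (toMats β (k s), sj s)) s).1) + Q), sj₁)
                else (fun s => (toMats β (k s), sj s)) ⟨j.val - 2 - 1, by omega⟩) *
              I₂ 4 r₂ t (fun j : Fin 4 =>
                if hj : j.val < 1 then legFlip ((fun s => (toMats β (k s), sj s)) ⟨0 - j.val, by omega⟩)
                else if hj' : j.val = 1 then
                  legFlip ((-(∑ s, ((fun s => (toMats β (k s), sj s)) s).1) + Q), sj₁)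
                else P ⟨2 + (j.val - 2), by omega⟩)‖ ≤ ENNReal.ofReal (4 * (A₁ * A₂ * Y)) :=
      (lintegral_mono fun k => hpt k).trans hint
    calc _ ≤ (ENNReal.ofReal (4 * (A₁ * A₂ * Y))).toReal := ENNReal.toReal_mono ENNReal.ofReal_ne_top hfin
      _ = 4 * (A₁ * A₂ * Y) := ENNReal.toReal_ofReal (by positivity)
  unfold bubbleTerm loopInt
  have hc : ‖(((Nat.factorial 2 * 2 : ℕ) : ℝ) : ℂ)‖ = 4 := by
    norm_num [Nat.factorial]
  calc _ ≤ ‖(((Nat.factorial 2 * 2 : ℕ) : ℝ) : ℂ)‖ *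
        ∑ sj : Fin 1 → Fin 2 × Fin 2, 4 * (A₁ * A₂ * Y) := by
        rw [norm_mul]
        gcongr
        exact (norm_sum_le _ _).trans (Finset.sum_le_sum fun sj _ => hterm sj)
    _ = 64 * (A₁ * A₂ * Y) := by
        rw [hc, Finset.sum_const, Finset.card_univ]
        simp only [Fintype.card_pi, Fintype.card_prod, Fintype.card_fin, Finset.prod_const, Finset.card_univ,
          nsmul_eq_mul]
        norm_num
        ring

/-! ### §D. Auxiliaries for the induction: `𝔸₄`, vanishing beyond `T* = log(βε₀/π)`, the `s`-integral -/

/-- At `m = 4` the four-point family is the ladder function itself. [cite: Salmhofer1998, Definition 3 (p.23 L142–150)] -/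
@[simp] theorem fourPointFamily_four (BL : ℕ → ℝ → (Fin 4 → Leg d) → ℂ) (r : ℕ) (t : ℝ) (P : Fin 4 → Leg d) :
    fourPointFamily BL 4 r t P = BL r t P := by
  simp [fourPointFamily]

/-- `|𝔸_m F(P)| ≤ sup |F|`: the antisymmetrisation is an average of `m!` signed evaluations (p.12 L116–122; "`|𝔸_m F|_0 ≤
|F|_0`"). [cite: Salmhofer1998, §3.2 (p.12 L116–122)] -/
theorem norm_antisym_le_of_le {Γ : Type*} {m : ℕ} (F : (Fin m → Γ) → ℂ) {g : ℝ} (hF : ∀ X, ‖F X‖ ≤ g)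
    (X : Fin m → Γ) : ‖antisym F X‖ ≤ g := by
  -- from the averaged form `norm_antisym_le` of the Theorem 1 proof file
  refine (norm_antisym_le F X).trans ?_
  calc (m.factorial : ℝ)⁻¹ * ∑ π : Equiv.Perm (Fin m), ‖F (X ∘ π)‖
      ≤ (m.factorial : ℝ)⁻¹ * ∑ _π : Equiv.Perm (Fin m), g := by
        gcongr with π _
        exact hF _
    _ = g := by
        rw [Finset.sum_const, Finset.card_univ, Fintype.card_perm, Fintype.card_fin, nsmul_eq_mul]
        have h : (m.factorial : ℝ) ≠ 0 := by positivity
        field_simp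

/-- Both Nambu components of the loop-line propagator vanish beyond `log(βε₀/π)`: `Ĉ_t(±(ω_β(k₀), 𝐤)) = 0`
(Lemma 4: `|ω_β| ≥ π/β > ε_t`). [cite: Salmhofer1998, Lemma 4 (p.19 L133–135)] -/
theorem modelProp_smul_toMats_eq_zero {M : ModelData d} (hM : M.Hyp) {χ₁ : ℝ → ℝ} (hχ : IsCutoff χ₁) {β : ℝ}
    (hβ : 0 < β) {t : ℝ} (ht : Real.log (β * M.eps0 / Real.pi) < t) {s : ℝ} (hs : s = 1 ∨ s = -1)
    (k : FMom d) : modelProp M χ₁ t (s • toMats β k) = 0 := by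
  rcases hs with rfl | rfl
  · rw [one_smul, modelProp_toMats]
    exact cutoffCovInf_eq_zero_of_log_lt M hχ hM.eps0_pos hβ ht _ _
  · rw [neg_one_smul]
    show covC χ₁ M.eps0 t (-(toMats β k)).1 (M.E (-(toMats β k)).2) = 0
    apply covC_eq_zero_of_lt hχ hM.eps0_pos
    have hπ := Real.pi_pos
    have h0 := hM.eps0_pos
    have hxge : Real.pi / β ≤ |(-(toMats β k)).1| := by
      simp only [toMats, Prod.fst_neg, abs_neg]
      exact pi_div_le_abs_omegaStep hβ k.1
    have hc : Real.pi / β ≤ ‖Complex.I * ((-(toMats β k)).1 : ℂ) - (M.E (-(toMats β k)).2 : ℂ)‖ := by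
      refine le_trans hxge ?_
      have := Complex.abs_im_le_norm (Complex.I * ((-(toMats β k)).1 : ℂ) - (M.E (-(toMats β k)).2 : ℂ))
      simpa using this
    refine lt_of_lt_of_le ?_ hc
    -- `ε₀ e^{-t} < π/β` iff `log(βε₀/π) < t`
    have h1 : β * M.eps0 / Real.pi < Real.exp t := by
      rw [← Real.exp_log (by positivity : 0 < β * M.eps0 / Real.pi)]
      exact Real.exp_lt_exp.mpr ht
    unfold epsT
    rw [lt_div_iff₀ hβ]
    have h2 : β * M.eps0 < Real.pi * Real.exp t := by
      rw [div_lt_iff₀ hπ] at h1; linarith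
    calc M.eps0 * Real.exp (-t) * β = β * M.eps0 * Real.exp (-t) := by ring
      _ < Real.pi * Real.exp t * Real.exp (-t) := by gcongr
      _ = Real.pi := by rw [mul_assoc, ← Real.exp_add, add_neg_cancel, Real.exp_zero, mul_one]

/-- Beyond `log(βε₀/π)` the bubble term vanishes at every external momentum (the loop line carries
`Ĉ_s(ω_β(k₀), 𝐤) = 0`). [cite: Salmhofer1998, Lemma 4 (p.19 L133–135) and (6.17) (p.23 L101–112)] -/
theorem bubbleTerm_eq_zero_of_log_lt {M : ModelData d} (hM : M.Hyp) {χ₁ : ℝ → ℝ} (hχ : IsCutoff χ₁) {β : ℝ}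
    (hβ : 0 < β) (I₁ I₂ : MomFamily d) (r₁ r₂ : ℕ) {t : ℝ} (ht : Real.log (β * M.eps0 / Real.pi) < t)
    (P : Fin 4 → Leg d) : bubbleTerm M.latt β (modelProp M χ₁) (modelPropDot M χ₁) I₁ I₂ r₁ r₂ t P = 0 := by
  have hzero : ∀ (k : Fin 1 → FMom d) (sj : Fin 1 → Fin 2 × Fin 2),
      legProp (modelProp M χ₁) t (toMats β (k 0), sj 0) = 0 := by
    intro k sj
    simp only [legProp]
    split_ifs
    · rw [show -(toMats β (k 0)) = (-1 : ℝ) • toMats β (k 0) by rw [neg_one_smul],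
        modelProp_smul_toMats_eq_zero hM hχ hβ ht (Or.inr rfl), neg_zero]
    · rw [show toMats β (k 0) = (1 : ℝ) • toMats β (k 0) by rw [one_smul],
        modelProp_smul_toMats_eq_zero hM hχ hβ ht (Or.inl rfl)]
  unfold bubbleTerm loopInt
  simp [hzero]

/-- `∫₀^m ((1+s)/2)^n ds = (2/(n+1)) (((1+m)/2)^{n+1} - (1/2)^{n+1})` ("by integration", the scale integral of
Theorem 3's induction). [cite: Salmhofer1998, Theorem 3 proof (p.23 L180–183)] -/
theorem integral_half_pow (n : ℕ) (m : ℝ) :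
    ∫ s in (0 : ℝ)..m, ((1 + s) / 2) ^ n =
      2 / (n + 1) * (((1 + m) / 2) ^ (n + 1) - (1 / 2) ^ (n + 1)) := by
  have hderiv : ∀ x ∈ Set.uIcc (0 : ℝ) m,
      HasDerivAt (fun s : ℝ => 2 / (n + 1) * ((1 + s) / 2) ^ (n + 1)) (((1 + x) / 2) ^ n) x := by
    intro x _
    have h1 : HasDerivAt (fun s : ℝ => (1 + s) / 2) (1 / 2) x := by
      have := ((hasDerivAt_id x).const_add 1).div_const 2
      simpa using this
    have h2 := (h1.pow (n + 1)).const_mul ((2 : ℝ) / (n + 1))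
    have hn : ((n : ℝ) + 1) ≠ 0 := by positivity
    refine h2.congr_deriv ?_
    rw [Nat.add_sub_cancel]
    push_cast
    rw [div_mul_eq_mul_div, div_eq_iff hn]
    ring
  rw [intervalIntegral.integral_eq_sub_of_hasDerivAt hderiv
    ((by fun_prop : Continuous fun s : ℝ => ((1 + s) / 2) ^ n).intervalIntegrable _ _)]
  simp only [add_zero]
  ring

/-! ### §E. Theorem 3: the induction on `r` and the assembly -/

/-- **The inductive bound for the ladder functions** (proof of Theorem 3, for the many-fermion propagator): with
`Γ = 18432 J₁ B` (`= 36 · (2!·2) · 4 · 4 · 8J₁B`), `L = 2w(1+Γ)` and `T* = log(βε₀/π)`, every ladder solution with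
`|B^L_r(0)| ≤ w^r` satisfies, for all `r ≥ 1`, `t ≥ 0` and all legs `P`,
`|B^L_r(t | P)| ≤ (L^r/(1+Γ)) ((1 + min(t, T*))/2)^{r-1}` — the `1/(r-1)` of the scale integral
`∫₀ᵗ ((1+s)/2)^{r-2} ds` exactly compensating the `r - 1` terms of `Σ_{r₁+r₂=r}`, and the loop line vanishing
beyond `T*`. [cite: Salmhofer1998, Theorem 3 (p.23 L169 – p.24 L10)] -/
theorem ladder_inductive_bound {M : ModelData d} (hM : M.Hyp) {χ₁ : ℝ → ℝ} (hχ : IsCutoff χ₁)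
    {B J₁ w β : ℝ} (hB : 0 ≤ B) (hJ : 0 ≤ J₁) (hw : 0 ≤ w) (hβ : 0 < β) (hβε : 6 ≤ β * M.eps0)
    (hloop : ∀ t : ℝ, 0 ≤ t →
      loopY M.latt β (modelProp M χ₁) (modelPropDot M χ₁) (0 : Fin d → ℕ) 1 t ≤ ENNReal.ofReal (8 * J₁ * B))
    {BL : ℕ → ℝ → (Fin 4 → Leg d) → ℂ}
    (hsol : IsLadderSolution M.latt β (modelProp M χ₁) (modelPropDot M χ₁) BL)
    (hinit : ∀ r : ℕ, 1 ≤ r → ∀ P : Fin 4 → Leg d, ‖BL r 0 P‖ ≤ w ^ r) :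
    ∀ r : ℕ, 1 ≤ r → ∀ t : ℝ, 0 ≤ t → ∀ P : Fin 4 → Leg d,
      ‖BL r t P‖ ≤ (2 * w * (1 + 18432 * J₁ * B)) ^ r / (1 + 18432 * J₁ * B) *
        ((1 + min t (Real.log (β * M.eps0 / Real.pi))) / 2) ^ (r - 1) := by
  set Γ : ℝ := 18432 * J₁ * B with hΓ
  set G : ℝ := 1 + Γ with hG
  set L : ℝ := 2 * w * G with hL
  set Ts : ℝ := Real.log (β * M.eps0 / Real.pi) with hTs
  have hΓ0 : 0 ≤ Γ := by positivity
  have hG1 : 1 ≤ G := by rw [hG]; linarith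
  have hG0 : 0 < G := by linarith
  have hGne : G ≠ 0 := hG0.ne'
  have hL0 : 0 ≤ L := by positivity
  have hTs0 : 0 < Ts := by
    rw [hTs]
    apply Real.log_pos
    rw [lt_div_iff₀ Real.pi_pos]
    linarith [Real.pi_lt_four]
  -- the RGE at `m = 4`
  have hRGE : ∀ (r : ℕ) (t : ℝ), 0 ≤ t → ∀ P : Fin 4 → Leg d,
      BL r t P = BL r 0 P + (2 : ℂ)⁻¹ * antisym (fun P' => ∫ s in (0 : ℝ)..t,
        ∑ r₁ ∈ Finset.Icc 1 (r - 1), (36 : ℂ) *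
          bubbleTerm M.latt β (modelProp M χ₁) (modelPropDot M χ₁) (fourPointFamily BL) (fourPointFamily BL)
            r₁ (r - r₁) s P') P := by
    intro r t ht P
    have h := hsol 4 r t ht P
    simp only [fourPointFamily_four, momQuadTerm_four_selLadder] at h
    exact h
  intro r
  induction r using Nat.strong_induction_on with
  | _ r ih =>
    intro hr t ht P
    have hm0 : 0 ≤ min t Ts := le_min ht hTs0.le
    rcases Nat.lt_or_ge r 2 with hr1 | hr2
    · -- `r = 1`: `Q_{4,1} = 0`, so `B_1(t) = B_1(0)`
      obtain rfl : r = 1 := by omega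
      have h := hRGE 1 t ht P
      simp only [Nat.sub_self, show Finset.Icc 1 0 = ∅ by decide, Finset.sum_empty,
        intervalIntegral.integral_zero] at h
      have hA : antisym (fun _ : Fin 4 → Leg d => (0 : ℂ)) P = 0 := by
        simp [antisym]
      rw [hA, mul_zero, add_zero] at h
      rw [h, pow_one, Nat.sub_self, pow_zero, mul_one]
      calc ‖BL 1 0 P‖ ≤ w ^ 1 := hinit 1 le_rfl P
        _ = L / (2 * G) := by rw [hL, pow_one]; field_simp
        _ ≤ L / G := by
            apply div_le_div_of_nonneg_left hL0 hG0
            linarith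
    · -- `r ≥ 2`: write `r = n + 2`
      obtain ⟨n, rfl⟩ : ∃ n, r = n + 2 := ⟨r - 2, by omega⟩
      simp only [show n + 2 - 1 = n + 1 by omega]
      set m : ℝ := min t Ts with hmdef
      set X : ℝ := ((1 + m) / 2) ^ (n + 1) with hXdef
      have hX0 : 0 < X := by positivity
      have hXge : (1 / 2 : ℝ) ^ (n + 1) ≤ X := by
        rw [hXdef]
        apply pow_le_pow_left₀ (by norm_num)
        linarith
      -- the bound on the two factors from the inductive hypothesis, at ALL legs, for `0 ≤ s`
      have hfac : ∀ r₁ : ℕ, 1 ≤ r₁ → r₁ < n + 2 → ∀ s : ℝ, 0 ≤ s → ∀ L' : Fin 4 → Leg d,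
          ‖fourPointFamily BL 4 r₁ s L'‖ ≤ L ^ r₁ / G * ((1 + s) / 2) ^ (r₁ - 1) := by
        intro r₁ hr₁ hr₁' s hs L'
        rw [fourPointFamily_four]
        refine (ih r₁ hr₁' hr₁ s hs L').trans ?_
        have hmin : min s Ts ≤ s := min_le_left _ _
        have h0 : 0 ≤ min s Ts := le_min hs hTs0.le
        gcongr
      -- pointwise bound on the right-hand side of the RGE for `0 ≤ s`, and its vanishing beyond `T*`
      set c : ℝ := 36 * (64 * (L ^ (n + 2) / G ^ 2 * (8 * J₁ * B))) with hcdef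
      have hc0 : 0 ≤ c := by positivity
      have hQ : ∀ s : ℝ, 0 ≤ s → ∀ P' : Fin 4 → Leg d,
          ‖∑ r₁ ∈ Finset.Icc 1 (n + 1), (36 : ℂ) *
              bubbleTerm M.latt β (modelProp M χ₁) (modelPropDot M χ₁) (fourPointFamily BL) (fourPointFamily BL)
                r₁ (n + 2 - r₁) s P'‖ ≤ (n + 1) * (c * ((1 + s) / 2) ^ n) := by
        intro s hs P'
        refine (norm_sum_le _ _).trans ?_
        have hcard : (Finset.Icc 1 (n + 1)).card = n + 1 := by simp
        calc ∑ r₁ ∈ Finset.Icc 1 (n + 1), ‖(36 : ℂ) *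
              bubbleTerm M.latt β (modelProp M χ₁) (modelPropDot M χ₁) (fourPointFamily BL) (fourPointFamily BL)
                r₁ (n + 2 - r₁) s P'‖
            ≤ ∑ r₁ ∈ Finset.Icc 1 (n + 1), c * ((1 + s) / 2) ^ n := by
              refine Finset.sum_le_sum fun r₁ hr₁ => ?_
              obtain ⟨hr1a, hr1b⟩ := Finset.mem_Icc.mp hr₁
              rw [norm_mul, show ‖(36 : ℂ)‖ = 36 by norm_num]
              have hb := norm_bubbleTerm_le hM hχ (I₁ := fourPointFamily BL) (I₂ := fourPointFamily BL)
                (r₁ := r₁) (r₂ := n + 2 - r₁) (t := s) (β := β)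
                (A₁ := L ^ r₁ / G * ((1 + s) / 2) ^ (r₁ - 1))
                (A₂ := L ^ (n + 2 - r₁) / G * ((1 + s) / 2) ^ (n + 2 - r₁ - 1))
                (Y := 8 * J₁ * B) (by positivity) (by positivity) (by positivity)
                (hfac r₁ hr1a (by omega) s hs) (hfac (n + 2 - r₁) (by omega) (by omega) s hs) (hloop s hs) P'
              refine (mul_le_mul_of_nonneg_left hb (by norm_num)).trans (le_of_eq ?_)
              have e1 : L ^ (n + 2) = L ^ r₁ * L ^ (n + 2 - r₁) := by
                rw [← pow_add]; congr 1; omega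
              have e2 : ((1 + s) / 2) ^ n = ((1 + s) / 2) ^ (r₁ - 1) * ((1 + s) / 2) ^ (n + 2 - r₁ - 1) := by
                rw [← pow_add]; congr 1; omega
              rw [hcdef, e1, e2]
              field_simp
          _ = (n + 1) * (c * ((1 + s) / 2) ^ n) := by
              rw [Finset.sum_const, hcard, nsmul_eq_mul]
              push_cast
              ring
      have hQ0 : ∀ s : ℝ, Ts < s → ∀ P' : Fin 4 → Leg d,
          (∑ r₁ ∈ Finset.Icc 1 (n + 1), (36 : ℂ) *
              bubbleTerm M.latt β (modelProp M χ₁) (modelPropDot M χ₁) (fourPointFamily BL) (fourPointFamily BL)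
                r₁ (n + 2 - r₁) s P') = 0 := by
        intro s hs P'
        refine Finset.sum_eq_zero fun r₁ _ => ?_
        rw [bubbleTerm_eq_zero_of_log_lt hM hχ hβ _ _ _ _ hs, mul_zero]
      -- the majorant `g = 1(s ≤ T*) q(s)` and its integral
      set q : ℝ → ℝ := fun s => (n + 1) * (c * ((1 + s) / 2) ^ n) with hqdef
      have hqcont : Continuous q := by rw [hqdef]; fun_prop
      set g : ℝ → ℝ := (Set.Iic Ts).indicator q with hgdef
      have hgint : IntegrableOn g (Set.Ioc 0 t) := by
        rw [hgdef]
        exact ((hqcont.integrableOn_Icc (a := 0) (b := t)).mono_set Set.Ioc_subset_Icc_self).indicator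
          measurableSet_Iic
      have hInt : ∀ P' : Fin 4 → Leg d,
          ‖∫ s in (0 : ℝ)..t, ∑ r₁ ∈ Finset.Icc 1 (n + 1), (36 : ℂ) *
              bubbleTerm M.latt β (modelProp M χ₁) (modelPropDot M χ₁) (fourPointFamily BL) (fourPointFamily BL)
                r₁ (n + 2 - r₁) s P'‖ ≤ 2 * Γ * (L ^ (n + 2) / G ^ 2) * X := by
        intro P'
        rw [intervalIntegral.integral_of_le ht]
        have hae : ∀ᵐ s ∂(volume.restrict (Set.Ioc 0 t)),
            ‖∑ r₁ ∈ Finset.Icc 1 (n + 1), (36 : ℂ) *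
              bubbleTerm M.latt β (modelProp M χ₁) (modelPropDot M χ₁) (fourPointFamily BL) (fourPointFamily BL)
                r₁ (n + 2 - r₁) s P'‖ ≤ g s := by
          refine (ae_restrict_iff' measurableSet_Ioc).mpr (Filter.Eventually.of_forall fun s hs => ?_)
          rw [hgdef, Set.indicator_apply]
          split_ifs with hsT
          · exact hQ s hs.1.le P'
          · rw [hQ0 s (lt_of_not_ge hsT) P', norm_zero]
        refine (norm_integral_le_of_norm_le hgint hae).trans ?_
        -- `∫_{(0,t]} g = ∫_0^m q`
        have hset : Set.Ioc 0 t ∩ Set.Iic Ts = Set.Ioc 0 m := by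
          ext s
          simp only [Set.mem_inter_iff, Set.mem_Iic, Set.mem_Ioc, hmdef, le_min_iff]
          tauto
        rw [hgdef, setIntegral_indicator measurableSet_Iic, hset, ← intervalIntegral.integral_of_le hm0]
        rw [hqdef, intervalIntegral.integral_const_mul, intervalIntegral.integral_const_mul, integral_half_pow]
        have hn1 : ((n : ℝ) + 1) ≠ 0 := by positivity
        have hdrop : ((1 + m) / 2) ^ (n + 1) - (1 / 2 : ℝ) ^ (n + 1) ≤ X := by
          rw [hXdef]; linarith [pow_pos (by norm_num : (0 : ℝ) < 1 / 2) (n + 1)]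
        calc ((n : ℝ) + 1) * (c * (2 / (n + 1) * (((1 + m) / 2) ^ (n + 1) - (1 / 2) ^ (n + 1))))
            = 2 * c * (((1 + m) / 2) ^ (n + 1) - (1 / 2) ^ (n + 1)) := by field_simp
          _ ≤ 2 * c * X := by gcongr
          _ = 2 * Γ * (L ^ (n + 2) / G ^ 2) * X := by rw [hcdef, hΓ]; ring
      -- assemble
      have h := hRGE (n + 2) t ht P
      simp only [show n + 2 - 1 = n + 1 by omega] at h
      rw [h]
      have hanti := norm_antisym_le_of_le (fun P' => ∫ s in (0 : ℝ)..t, ∑ r₁ ∈ Finset.Icc 1 (n + 1), (36 : ℂ) *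
              bubbleTerm M.latt β (modelProp M χ₁) (modelPropDot M χ₁) (fourPointFamily BL) (fourPointFamily BL)
                r₁ (n + 2 - r₁) s P') hInt P
      have hwr : w ^ (n + 2) ≤ L ^ (n + 2) / G ^ 2 * ((1 / 2) * X) := by
        have h2X : 1 ≤ 2 ^ (n + 1) * X := by
          calc (1 : ℝ) = 2 ^ (n + 1) * (1 / 2) ^ (n + 1) := by
                rw [← mul_pow]; norm_num
            _ ≤ 2 ^ (n + 1) * X := by gcongr
        have hGn : 1 ≤ G ^ n := one_le_pow₀ hG1
        calc w ^ (n + 2) = w ^ (n + 2) * 1 * 1 := by ring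
          _ ≤ w ^ (n + 2) * G ^ n * (2 ^ (n + 1) * X) := by gcongr
          _ = L ^ (n + 2) / G ^ 2 * ((1 / 2) * X) := by
              rw [hL, mul_pow, mul_pow]
              field_simp
              ring
      calc ‖BL (n + 2) 0 P + 2⁻¹ * antisym _ P‖
          ≤ ‖BL (n + 2) 0 P‖ + ‖(2 : ℂ)⁻¹ * antisym _ P‖ := norm_add_le _ _
        _ ≤ w ^ (n + 2) + 2⁻¹ * (2 * Γ * (L ^ (n + 2) / G ^ 2) * X) := by
            gcongr
            · exact hinit (n + 2) (by omega) P
            · rw [norm_mul, show ‖(2 : ℂ)⁻¹‖ = 2⁻¹ by norm_num]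
              gcongr
        _ ≤ L ^ (n + 2) / G ^ 2 * ((1 / 2) * X) + Γ * (L ^ (n + 2) / G ^ 2) * X := by
            rw [show (2 : ℝ)⁻¹ * (2 * Γ * (L ^ (n + 2) / G ^ 2) * X) =
              Γ * (L ^ (n + 2) / G ^ 2) * X by ring]
            gcongr
        _ = L ^ (n + 2) / G ^ 2 * X * (1 / 2 + Γ) := by ring
        _ ≤ L ^ (n + 2) / G ^ 2 * X * G := by
            gcongr
            rw [hG]; norm_num
        _ = L ^ (n + 2) / G * X := by field_simp

/-- **Theorem 3 of [Sal98], discharged** (`LadderFourPointBound_holds : LadderFourPointBound`).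
For the model propagators `(C, Ċ)` of (5.17) and every solution `B_r` of the ladder RGE (6.15)/(6.16)
with `|B_r(0)|₀ ≤ w^r`, there is `L₂ > 0` (here `L₂ = max (2w(1 + 18432 J₁ B)) 1`) with
`|B_r(t)|₀ ≤ L₂^r ((1+t)/2)^{r-1} ≤ L₂^r |log βε₀|^{r-1}` on Matsubara legs, and `∑_r λ^r B_r`
converges uniformly in `t` and the external legs for `|λ log βε₀| < L₂⁻¹`.  The proof is the
printed one: induction on `r` from (6.17) with Lemma 8 (6.14) at `i = 2`, `α = 0`
(`ladder_inductive_bound`), followed by the Weierstrass M-test.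
[cite: Salmhofer1998, §6.2, Theorem 3, (6.17)–(6.18), p. 23] -/
theorem LadderFourPointBound_holds : LadderFourPointBound := by
  intro d M χ₁ B J₁ w _hd hM hχ hB hJ hw
  set L : ℝ := 2 * w * (1 + 18432 * J₁ * B) with hL
  have hΓ0 : 0 ≤ 18432 * J₁ * B := by positivity
  have hL0 : 0 ≤ L := by positivity
  refine ⟨max L 1, by positivity, ?_⟩
  intro β hβ hβε hloop BL hsol hinit
  set L₂ : ℝ := max L 1 with hL₂
  have hL₂1 : 1 ≤ L₂ := le_max_right _ _
  have hLL₂ : L ≤ L₂ := le_max_left _ _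
  have hL₂0 : 0 < L₂ := by positivity
  set Ts : ℝ := Real.log (β * M.eps0 / Real.pi) with hTs
  have hTs0 : 0 < Ts := by
    rw [hTs]
    apply Real.log_pos
    rw [lt_div_iff₀ Real.pi_pos]
    linarith [Real.pi_lt_four]
  have hlog1 : 1 ≤ Real.log (β * M.eps0) := by
    rw [Real.le_log_iff_exp_le (by linarith)]
    have := Real.exp_one_lt_d9
    linarith
  have hlogabs : |Real.log (β * M.eps0)| = Real.log (β * M.eps0) := abs_of_pos (by linarith)
  have hTs_le : Ts ≤ Real.log (β * M.eps0) := by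
    rw [hTs]
    exact Real.log_le_log (by positivity) (div_le_self (by linarith) (by linarith [Real.pi_gt_three]))
  -- the inductive bound (6.17)
  have key := ladder_inductive_bound hM hχ hB hJ.le hw hβ hβε hloop hsol hinit
  have hpre : ∀ r : ℕ, L ^ r / (1 + 18432 * J₁ * B) ≤ L₂ ^ r := by
    intro r
    calc L ^ r / (1 + 18432 * J₁ * B) ≤ L ^ r := div_le_self (by positivity) (by linarith)
      _ ≤ L₂ ^ r := pow_le_pow_left₀ hL0 hLL₂ r
  have hmin0 : ∀ t : ℝ, 0 ≤ t → 0 ≤ (1 + min t Ts) / 2 := fun t ht => by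
    have := le_min ht hTs0.le
    positivity
  -- (ii): the `log βε₀` form, valid at every leg configuration
  have hii : ∀ t : ℝ, 0 ≤ t → ∀ r : ℕ, 1 ≤ r → ∀ P : Fin 4 → Leg d,
      ‖BL r t P‖ ≤ L₂ ^ r * |Real.log (β * M.eps0)| ^ (r - 1) := by
    intro t ht r hr P
    refine (key r hr t ht P).trans ?_
    have hb : (1 + min t Ts) / 2 ≤ |Real.log (β * M.eps0)| := by
      rw [hlogabs]
      have := min_le_right t Ts
      linarith
    exact mul_le_mul (hpre r) (pow_le_pow_left₀ (hmin0 t ht) hb _) (by positivity) (by positivity)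
  refine ⟨fun t ht r hr P => ?_, fun t ht r hr P _ => hii t ht r hr P, fun lam hlam => ?_⟩
  · -- (i)
    refine (key r hr t ht P).trans ?_
    have hb : (1 + min t Ts) / 2 ≤ (1 + t) / 2 := by
      have := min_le_left t Ts
      linarith
    exact mul_le_mul (hpre r) (pow_le_pow_left₀ (hmin0 t ht) hb _) (by positivity) (by positivity)
  · -- (iii): Weierstrass M-test with the geometric majorant `|λ| L₂ (|λ| L₂ |log βε₀|)^r`
    set a : ℝ := |Real.log (β * M.eps0)| with ha
    have ha0 : 0 ≤ a := abs_nonneg _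
    have hρ0 : 0 ≤ |lam| * L₂ * a := by positivity
    have hρ1 : |lam| * L₂ * a < 1 := by
      have h1 : |lam * Real.log (β * M.eps0)| = |lam| * a := by rw [abs_mul]
      calc |lam| * L₂ * a = L₂ * (|lam| * a) := by ring
        _ < L₂ * L₂⁻¹ := by rw [← h1]; exact mul_lt_mul_of_pos_left hlam hL₂0
        _ = 1 := mul_inv_cancel₀ hL₂0.ne'
    have hu : Summable fun r : ℕ => |lam| * L₂ * (|lam| * L₂ * a) ^ r :=
      (summable_geometric_of_lt_one hρ0 hρ1).mul_left _
    refine tendstoUniformlyOn_tsum_nat hu fun r tp htp => ?_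
    obtain ⟨ht, -⟩ := htp
    rw [norm_mul, norm_pow, Complex.norm_real, Real.norm_eq_abs]
    have hb := hii tp.1 ht (r + 1) (by omega) tp.2
    rw [Nat.add_sub_cancel] at hb
    calc |lam| ^ (r + 1) * ‖BL (r + 1) tp.1 tp.2‖ ≤ |lam| ^ (r + 1) * (L₂ ^ (r + 1) * a ^ r) := by gcongr
      _ = |lam| * L₂ * (|lam| * L₂ * a) ^ r := by ring

end Salmhofer1998

end Literature.MathematicalPhysics.QuantumLattice.FermiRG
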